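import Summits.CriticalPhenomena.PercolationContinuityZ3.Theorems.PercNearOneGluingNoHeavyQuantLightTwoBlobFlow
import Summits.CriticalPhenomena.PercolationContinuityZ3.Theorems.PercNearOneGluingNoHeavyQuantFlowUncross
import HarnessLib

/-!
# QUANT lane R8, T-DEC, binder (II) `ConvClosedTResidue`: LS-CORE, pattern MMG — usage of the cross pairs in scaled coordinates and the
# bookkeeping package of the six efficiencies / three exchange ratios (closed forms, signs, `κ·e₂ = e₁`)

builds on p205010 (kernel theorem, internal audit signed; external expert review pending)

Support file (`--supports stmt-CriticalPhenomena-4575`), QUANT lane seat prim-quant-census-1 (gen 22), rung R8 of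
`run/shared/lean/prim/quant/LADDER.md`.  Theorems only, standard axioms, no sorries.  Memo `…/prim-quant-census-1/LSCORE-G22.md` §2.
Serves `…QuantLSCoreMMG` (`lsCore_MMG_decAtT`).

* `LawDec.LSCoreMMG.usage_heavy_scaled` / `usage_light_scaled` — for a pair with deficit `T − 2lo = e·Δ` and span `hi − lo = e·δ`,
  `usage > 0` and `(δ/Δ − 1)·usage = 1` (heavy, `xδ ≤ Δ < δ`) resp. `(δ/((1−x)Δ + x²δ) − 1)·usage = 1` (light).
* `LawDec.LSCoreMMG.eff_package` — the efficiencies `e2P, e22, e21, e1P, e12, e11` and ratios `κC, κB, κA` as reals with their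
  conditional closed forms (absent / heavy / light), nonnegativity, and the identities `κ·e₂ = e₁`.

[this work].  The gluing rows served [cite: KozmaNitzan2024, Conjecture 3 (p. 15)]; product measure [cite: Grimmett1999, §1.3 p. 10].
-/

noncomputable section

namespace Summit.CriticalPhenomena.PercolationContinuityZ3.Theorems

namespace Quant

open Finset

namespace LawDec

namespace LSCoreMMG

/-- **usage of a compatible HEAVY mid in scaled coordinates**: `T − 2lo = e·Δ`, `hi − lo = e·δ`, `0 < e`, `x·δ ≤ Δ < δ` ⟹
`usage > 0` and `(δ/Δ − 1)·usage = 1`. [this work] -/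
theorem usage_heavy_scaled (x T e Δ δ : ℝ) (j lo hi : ℕ) (hx0 : 0 < x) (hx1 : x < 1) (he : 0 < e) (hhi : hi ≤ j)
    (hΔ : T - 2 * (lo : ℝ) = e * Δ) (hδ : (hi : ℝ) - lo = e * δ) (hΔ0 : 0 < Δ) (hcomp : Δ < δ) (hheavy : x * δ ≤ Δ) :
    0 < usage x T j lo hi ∧ (δ / Δ - 1) * usage x T j lo hi = 1 := by
  have hlow : 2 * (lo : ℝ) < T := by nlinarith
  have hc : T < (lo : ℝ) + hi := by nlinarith
  have hlh : lo < hi := by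
    have : (lo : ℝ) < hi := by nlinarith
    exact_mod_cast this
  refine ⟨usage_pos_of_compat x T j lo hi hx0 hx1 hlow hlh (Or.inr hc), ?_⟩
  rw [usage_eq_heavy' x T j lo hi hx0 hx1 hhi hlow hc (by rw [hδ, hΔ]; nlinarith)]
  rw [hΔ, show (lo : ℝ) + hi - T = e * (δ - Δ) by linear_combination hδ - hΔ, div_sub_one hΔ0.ne']
  have h1 : δ - Δ ≠ 0 := sub_ne_zero.2 (ne_of_gt hcomp)
  have h2 : e ≠ 0 := he.ne'
  have h3 : Δ ≠ 0 := hΔ0.ne'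
  field_simp

/-- **usage of a compatible LIGHT mid in scaled coordinates**: as above with `Δ ≤ x·δ` ⟹ `(δ/((1−x)Δ + x²δ) − 1)·usage = 1`. [this work] -/
theorem usage_light_scaled (x T e Δ δ : ℝ) (j lo hi : ℕ) (hx0 : 0 < x) (hx1 : x < 1) (he : 0 < e) (hhi : hi ≤ j)
    (hΔ : T - 2 * (lo : ℝ) = e * Δ) (hδ : (hi : ℝ) - lo = e * δ) (hΔ0 : 0 < Δ) (hcomp : Δ < δ) (hlight : Δ ≤ x * δ) :
    0 < usage x T j lo hi ∧ (δ / ((1 - x) * Δ + x ^ 2 * δ) - 1) * usage x T j lo hi = 1 := by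
  have hlow : 2 * (lo : ℝ) < T := by nlinarith
  have hc : T < (lo : ℝ) + hi := by nlinarith
  have hδ0 : 0 < δ := by linarith
  have hlh : lo < hi := by
    have : (lo : ℝ) < hi := by nlinarith
    exact_mod_cast this
  refine ⟨usage_pos_of_compat x T j lo hi hx0 hx1 hlow hlh (Or.inr hc), ?_⟩
  rw [usage_eq_light' x T j lo hi hx0 hx1 hhi hlow hc (by rw [hδ, hΔ]; nlinarith)]
  set G : ℝ := (1 - x) * Δ + x ^ 2 * δ with hG
  have hG0 : 0 < G := by rw [hG]; positivity
  have hδG : 0 < δ - G := by rw [hG]; nlinarith [mul_pos hx0 hδ0, mul_pos hx0 (sub_pos.2 hcomp)]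
  rw [show x ^ 2 * ((hi : ℝ) - lo) + (1 - x) * (T - 2 * (lo : ℝ)) = e * G by rw [hδ, hΔ, hG]; ring,
    show (1 - x) * ((1 - x) * (lo : ℝ) + (1 + x) * hi - T) = e * (δ - G) by rw [hG]; linear_combination (1 - x ^ 2) * hδ - (1 - x) * hΔ,
    div_sub_one hG0.ne']
  have h1 : δ - G ≠ 0 := hδG.ne'
  have h2 : e ≠ 0 := he.ne'
  have h3 : G ≠ 0 := hG0.ne'
  field_simp

set_option maxHeartbeats 4000000 in
/-- **the six efficiencies and three exchange ratios of the light-slice law, as reals with their conditional closed forms**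
(absent / heavy / light), their signs, and the identities `κ·e₂ = e₁` — pure real bookkeeping for `lsCore_MMG_decAtT`. [this work] -/
theorem eff_package (x r t d w : ℝ) (hx0 : 0 < x) (hx1 : x < 1) (ht : 0 < t) (hw0 : 0 < w) (hApos : 0 < r + d) :
    ∃ e2P e22 e21 e1P e12 e11 κC κB κA : ℝ,
      (1 ≤ (r + d) → e2P = 0) ∧
      (x ≤ (r + d) → (r + d) < 1 → e2P = (1 / (r + d) - 1)) ∧
      ((r + d) < x → e2P = (1 / ((1 - x) * (r + d) + x ^ 2) - 1)) ∧
      (w ≤ (r + d) → e22 = 0) ∧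
      (x * w ≤ (r + d) → (r + d) < w → e22 = (w / (r + d) - 1)) ∧
      ((r + d) < x * w → e22 = (w / ((1 - x) * (r + d) + x ^ 2 * w) - 1)) ∧
      (w - t ≤ (r + d) → e21 = 0) ∧
      (x * (w - t) ≤ (r + d) → (r + d) < w - t → e21 = ((w - t) / (r + d) - 1)) ∧
      ((r + d) < x * (w - t) → e21 = ((w - t) / ((1 - x) * (r + d) + x ^ 2 * (w - t)) - 1)) ∧
      (1 + t ≤ (r + d + 2 * t) → e1P = 0) ∧
      ((r + d + 2 * t) < 1 + t → e1P = ((1 + t) / (r + d + 2 * t) - 1)) ∧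
      (w + t ≤ (r + d + 2 * t) → e12 = 0) ∧
      ((r + d + 2 * t) < w + t → e12 = ((w + t) / (r + d + 2 * t) - 1)) ∧
      (w ≤ (r + d + 2 * t) → e11 = 0) ∧
      ((r + d + 2 * t) < w → e11 = (w / (r + d + 2 * t) - 1)) ∧
      (0 ≤ e2P) ∧
      (0 ≤ e22) ∧
      (0 ≤ e21) ∧
      (0 ≤ e1P) ∧
      (0 ≤ e12) ∧
      (0 ≤ e11) ∧
      (1 + t ≤ (r + d + 2 * t) → κC = 0) ∧
      ((r + d + 2 * t) < 1 + t → x ≤ (r + d) → (r + d) < 1 → κC = (((1 + t) - (r + d + 2 * t)) * (r + d) / ((r + d + 2 * t) * (1 - (r + d))))) ∧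
      ((r + d + 2 * t) < 1 + t → (r + d) < x → κC = (((1 + t) - (r + d + 2 * t)) * ((1 - x) * (r + d) + x ^ 2) / ((r + d + 2 * t) * (1 - ((1 - x) * (r + d) + x ^ 2))))) ∧
      (w + t ≤ (r + d + 2 * t) → κB = 0) ∧
      ((r + d + 2 * t) < w + t → x * w ≤ (r + d) → (r + d) < w → κB = (((w + t) - (r + d + 2 * t)) * (r + d) / ((r + d + 2 * t) * (w - (r + d))))) ∧
      ((r + d + 2 * t) < w + t → (r + d) < x * w → κB = (((w + t) - (r + d + 2 * t)) * ((1 - x) * (r + d) + x ^ 2 * w) / ((r + d + 2 * t) * (w - ((1 - x) * (r + d) + x ^ 2 * w))))) ∧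
      (w ≤ (r + d + 2 * t) → κA = 0) ∧
      ((r + d + 2 * t) < w → x * (w - t) ≤ (r + d) → (r + d) < w - t → κA = ((w - (r + d + 2 * t)) * (r + d) / ((r + d + 2 * t) * ((w - t) - (r + d))))) ∧
      ((r + d + 2 * t) < w → (r + d) < x * (w - t) → κA = ((w - (r + d + 2 * t)) * ((1 - x) * (r + d) + x ^ 2 * (w - t)) / ((r + d + 2 * t) * ((w - t) - ((1 - x) * (r + d) + x ^ 2 * (w - t)))))) ∧
      (0 ≤ κC) ∧
      (0 ≤ κB) ∧
      (0 ≤ κA) ∧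
      (((r + d + 2 * t) < 1 + t → κC * e2P = e1P)) ∧
      (((r + d + 2 * t) < w + t → κB * e22 = e12)) ∧
      (((r + d + 2 * t) < w → κA * e21 = e11)) := by
  classical
  have hBpos : 0 < r + d + 2 * t := by linarith
  have hxw1 : x * w ≤ w := mul_le_of_le_one_left hw0.le hx1.le
  have hwt_of : r + d < x * (w - t) → 0 < w - t := fun h1 => by
    by_contra hn
    have : x * (w - t) ≤ 0 := mul_nonpos_iff.2 (Or.inl ⟨hx0.le, not_lt.1 hn⟩)
    linarith
  set e2P : ℝ := if 1 ≤ r + d then 0 else if x ≤ r + d then (1 / (r + d) - 1) else (1 / ((1 - x) * (r + d) + x ^ 2) - 1) with he2P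
  set e22 : ℝ := if w ≤ r + d then 0 else if x * w ≤ r + d then (w / (r + d) - 1) else (w / ((1 - x) * (r + d) + x ^ 2 * w) - 1) with he22
  set e21 : ℝ := if w - t ≤ r + d then 0 else if x * (w - t) ≤ r + d then ((w - t) / (r + d) - 1)
    else ((w - t) / ((1 - x) * (r + d) + x ^ 2 * (w - t)) - 1) with he21
  set e1P : ℝ := if 1 + t ≤ r + d + 2 * t then 0 else ((1 + t) / (r + d + 2 * t) - 1) with he1P
  set e12 : ℝ := if w + t ≤ r + d + 2 * t then 0 else ((w + t) / (r + d + 2 * t) - 1) with he12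
  set e11 : ℝ := if w ≤ r + d + 2 * t then 0 else (w / (r + d + 2 * t) - 1) with he11
  set κC : ℝ := if 1 + t ≤ r + d + 2 * t then 0 else if x ≤ r + d
    then (((1 + t) - (r + d + 2 * t)) * (r + d) / ((r + d + 2 * t) * (1 - (r + d))))
    else (((1 + t) - (r + d + 2 * t)) * ((1 - x) * (r + d) + x ^ 2) / ((r + d + 2 * t) * (1 - ((1 - x) * (r + d) + x ^ 2)))) with hκC
  set κB : ℝ := if w + t ≤ r + d + 2 * t then 0 else if x * w ≤ r + d
    then (((w + t) - (r + d + 2 * t)) * (r + d) / ((r + d + 2 * t) * (w - (r + d))))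
    else (((w + t) - (r + d + 2 * t)) * ((1 - x) * (r + d) + x ^ 2 * w) / ((r + d + 2 * t) * (w - ((1 - x) * (r + d) + x ^ 2 * w)))) with hκB
  set κA : ℝ := if w ≤ r + d + 2 * t then 0 else if x * (w - t) ≤ r + d
    then ((w - (r + d + 2 * t)) * (r + d) / ((r + d + 2 * t) * ((w - t) - (r + d))))
    else ((w - (r + d + 2 * t)) * ((1 - x) * (r + d) + x ^ 2 * (w - t)) / ((r + d + 2 * t) * ((w - t) - ((1 - x) * (r + d) + x ^ 2 * (w - t))))) with hκA
  have h2P_N : 1 ≤ r + d → e2P = 0 := fun h1 => by rw [he2P, if_pos h1]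
  have h2P_H : x ≤ r + d → r + d < 1 → e2P = (1 / (r + d) - 1) := fun h1 h2 => by
    rw [he2P, if_neg (not_le.2 h2), if_pos h1]
  have h2P_L : r + d < x → e2P = (1 / ((1 - x) * (r + d) + x ^ 2) - 1) := fun h1 => by
    rw [he2P, if_neg (by linarith), if_neg (not_le.2 h1)]
  have h22_N : w ≤ r + d → e22 = 0 := fun h1 => by rw [he22, if_pos h1]
  have h22_H : x * w ≤ r + d → r + d < w → e22 = (w / (r + d) - 1) := fun h1 h2 => by
    rw [he22, if_neg (not_le.2 h2), if_pos h1]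
  have hxw1 : x * w ≤ w := mul_le_of_le_one_left hw0.le hx1.le
  have h22_L : r + d < x * w → e22 = (w / ((1 - x) * (r + d) + x ^ 2 * w) - 1) := fun h1 => by
    have : ¬ w ≤ r + d := not_le.2 (lt_of_lt_of_le h1 hxw1)
    rw [he22, if_neg this, if_neg (not_le.2 h1)]
  have h21_N : w - t ≤ r + d → e21 = 0 := fun h1 => by rw [he21, if_pos h1]
  have h21_H : x * (w - t) ≤ r + d → r + d < w - t → e21 = ((w - t) / (r + d) - 1) := fun h1 h2 => by
    rw [he21, if_neg (not_le.2 h2), if_pos h1]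
  have hwt_of : r + d < x * (w - t) → 0 < w - t := fun h1 => by
    by_contra hn
    have : x * (w - t) ≤ 0 := mul_nonpos_iff.2 (Or.inl ⟨hx0.le, not_lt.1 hn⟩)
    linarith
  have h21_L : r + d < x * (w - t) → e21 = ((w - t) / ((1 - x) * (r + d) + x ^ 2 * (w - t)) - 1) := fun h1 => by
    have hwt := hwt_of h1
    have : ¬ w - t ≤ r + d := not_le.2 (lt_of_lt_of_le h1 (mul_le_of_le_one_left hwt.le hx1.le))
    rw [he21, if_neg this, if_neg (not_le.2 h1)]
  have h1P_N : 1 + t ≤ r + d + 2 * t → e1P = 0 := fun h1 => by rw [he1P, if_pos h1]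
  have h1P_H : r + d + 2 * t < 1 + t → e1P = ((1 + t) / (r + d + 2 * t) - 1) := fun h1 => by rw [he1P, if_neg (not_le.2 h1)]
  have h12_N : w + t ≤ r + d + 2 * t → e12 = 0 := fun h1 => by rw [he12, if_pos h1]
  have h12_H : r + d + 2 * t < w + t → e12 = ((w + t) / (r + d + 2 * t) - 1) := fun h1 => by rw [he12, if_neg (not_le.2 h1)]
  have h11_N : w ≤ r + d + 2 * t → e11 = 0 := fun h1 => by rw [he11, if_pos h1]
  have h11_H : r + d + 2 * t < w → e11 = (w / (r + d + 2 * t) - 1) := fun h1 => by rw [he11, if_neg (not_le.2 h1)]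
  have hκC_N : 1 + t ≤ r + d + 2 * t → κC = 0 := fun h1 => by rw [hκC, if_pos h1]
  have hκC_H : r + d + 2 * t < 1 + t → x ≤ r + d → r + d < 1 →
      κC = (((1 + t) - (r + d + 2 * t)) * (r + d) / ((r + d + 2 * t) * (1 - (r + d)))) := fun h1 h2 _ => by
    rw [hκC, if_neg (not_le.2 h1), if_pos h2]
  have hκC_L : r + d + 2 * t < 1 + t → r + d < x →
      κC = (((1 + t) - (r + d + 2 * t)) * ((1 - x) * (r + d) + x ^ 2) / ((r + d + 2 * t) * (1 - ((1 - x) * (r + d) + x ^ 2)))) :=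
    fun h1 h2 => by rw [hκC, if_neg (not_le.2 h1), if_neg (not_le.2 h2)]
  have hκB_N : w + t ≤ r + d + 2 * t → κB = 0 := fun h1 => by rw [hκB, if_pos h1]
  have hκB_H : r + d + 2 * t < w + t → x * w ≤ r + d → r + d < w →
      κB = (((w + t) - (r + d + 2 * t)) * (r + d) / ((r + d + 2 * t) * (w - (r + d)))) := fun h1 h2 _ => by
    rw [hκB, if_neg (not_le.2 h1), if_pos h2]
  have hκB_L : r + d + 2 * t < w + t → r + d < x * w →
      κB = (((w + t) - (r + d + 2 * t)) * ((1 - x) * (r + d) + x ^ 2 * w) / ((r + d + 2 * t) * (w - ((1 - x) * (r + d) + x ^ 2 * w)))) :=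
    fun h1 h2 => by rw [hκB, if_neg (not_le.2 h1), if_neg (not_le.2 h2)]
  have hκA_N : w ≤ r + d + 2 * t → κA = 0 := fun h1 => by rw [hκA, if_pos h1]
  have hκA_H : r + d + 2 * t < w → x * (w - t) ≤ r + d → r + d < w - t →
      κA = ((w - (r + d + 2 * t)) * (r + d) / ((r + d + 2 * t) * ((w - t) - (r + d)))) := fun h1 h2 _ => by
    rw [hκA, if_neg (not_le.2 h1), if_pos h2]
  have hκA_L : r + d + 2 * t < w → r + d < x * (w - t) →
      κA = ((w - (r + d + 2 * t)) * ((1 - x) * (r + d) + x ^ 2 * (w - t)) / ((r + d + 2 * t) * ((w - t) - ((1 - x) * (r + d) + x ^ 2 * (w - t))))) :=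
    fun h1 h2 => by rw [hκA, if_neg (not_le.2 h1), if_neg (not_le.2 h2)]
  -- ### signs of efficiencies and exchange ratios
  have hG2P : 0 < (1 - x) * (r + d) + x ^ 2 := by positivity
  have hG22 : 0 < (1 - x) * (r + d) + x ^ 2 * w := by positivity
  have hG2Px : r + d < x → (1 - x) * (r + d) + x ^ 2 < x := fun h1 => by
    have := mul_lt_mul_of_pos_left h1 (sub_pos.2 hx1)
    linarith
  have hG22w : r + d < x * w → (1 - x) * (r + d) + x ^ 2 * w < x * w := fun h1 => by
    have := mul_lt_mul_of_pos_left h1 (sub_pos.2 hx1)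
    have e1 : (1 - x) * (x * w) + x ^ 2 * w = x * w := by ring
    linarith
  have hG21w : r + d < x * (w - t) → 0 < (1 - x) * (r + d) + x ^ 2 * (w - t) ∧ (1 - x) * (r + d) + x ^ 2 * (w - t) < x * (w - t)
      ∧ x * (w - t) ≤ w - t := fun h1 => by
    have hwt := hwt_of h1
    have := mul_lt_mul_of_pos_left h1 (sub_pos.2 hx1)
    have e1 : (1 - x) * (x * (w - t)) + x ^ 2 * (w - t) = x * (w - t) := by ring
    refine ⟨by positivity, by linarith, mul_le_of_le_one_left hwt.le hx1.le⟩
  have he2P0 : 0 ≤ e2P := by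
    rcases lt_or_ge (r + d) x with h1 | h1
    · rw [h2P_L h1, sub_nonneg, le_div_iff₀ hG2P]; linarith [hG2Px h1]
    · rcases lt_or_ge (r + d) 1 with h2 | h2
      · rw [h2P_H h1 h2, sub_nonneg, le_div_iff₀ hApos]; linarith
      · rw [h2P_N h2]
  have he220 : 0 ≤ e22 := by
    rcases lt_or_ge (r + d) (x * w) with h1 | h1
    · rw [h22_L h1, sub_nonneg, le_div_iff₀ hG22]; linarith [hG22w h1]
    · rcases lt_or_ge (r + d) w with h2 | h2
      · rw [h22_H h1 h2, sub_nonneg, le_div_iff₀ hApos]; linarith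
      · rw [h22_N h2]
  have he210 : 0 ≤ e21 := by
    rcases lt_or_ge (r + d) (x * (w - t)) with h1 | h1
    · obtain ⟨hG21, hG21', hxwt'⟩ := hG21w h1
      rw [h21_L h1, sub_nonneg, le_div_iff₀ hG21]; linarith
    · rcases lt_or_ge (r + d) (w - t) with h2 | h2
      · rw [h21_H h1 h2, sub_nonneg, le_div_iff₀ hApos]; linarith
      · rw [h21_N h2]
  have he1P0 : 0 ≤ e1P := by
    rcases lt_or_ge (r + d + 2 * t) (1 + t) with h1 | h1
    · rw [h1P_H h1, sub_nonneg, le_div_iff₀ hBpos]; linarith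
    · rw [h1P_N h1]
  have he120 : 0 ≤ e12 := by
    rcases lt_or_ge (r + d + 2 * t) (w + t) with h1 | h1
    · rw [h12_H h1, sub_nonneg, le_div_iff₀ hBpos]; linarith
    · rw [h12_N h1]
  have he110 : 0 ≤ e11 := by
    rcases lt_or_ge (r + d + 2 * t) w with h1 | h1
    · rw [h11_H h1, sub_nonneg, le_div_iff₀ hBpos]; linarith
    · rw [h11_N h1]
  have hκC0 : 0 ≤ κC := by
    rcases lt_or_ge (r + d + 2 * t) (1 + t) with h1 | h1
    · rcases lt_or_ge (r + d) x with h2 | h2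
      · rw [hκC_L h1 h2]
        exact div_nonneg (mul_nonneg (by linarith) hG2P.le) (mul_nonneg hBpos.le (by linarith [hG2Px h2]))
      · rw [hκC_H h1 h2 (by linarith)]
        exact div_nonneg (mul_nonneg (by linarith) hApos.le) (mul_nonneg hBpos.le (by linarith))
    · rw [hκC_N h1]
  have hκB0 : 0 ≤ κB := by
    rcases lt_or_ge (r + d + 2 * t) (w + t) with h1 | h1
    · rcases lt_or_ge (r + d) (x * w) with h2 | h2
      · rw [hκB_L h1 h2]
        exact div_nonneg (mul_nonneg (by linarith) hG22.le) (mul_nonneg hBpos.le (by linarith [hG22w h2]))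
      · rw [hκB_H h1 h2 (by linarith)]
        exact div_nonneg (mul_nonneg (by linarith) hApos.le) (mul_nonneg hBpos.le (by linarith))
    · rw [hκB_N h1]
  have hκA0 : 0 ≤ κA := by
    rcases lt_or_ge (r + d + 2 * t) w with h1 | h1
    · rcases lt_or_ge (r + d) (x * (w - t)) with h2 | h2
      · obtain ⟨hG21, hG21', hxwt'⟩ := hG21w h2
        rw [hκA_L h1 h2]
        exact div_nonneg (mul_nonneg (by linarith) hG21.le) (mul_nonneg hBpos.le (by linarith))
      · rw [hκA_H h1 h2 (by linarith)]
        exact div_nonneg (mul_nonneg (by linarith) hApos.le) (mul_nonneg hBpos.le (by linarith))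
    · rw [hκA_N h1]
  -- exchange ratios: `κ·e₂ = e₁` on the closed forms
  have hκCe : r + d + 2 * t < 1 + t → κC * e2P = e1P := by
    intro h1
    have hB0 : r + d + 2 * t ≠ 0 := hBpos.ne'
    rw [h1P_H h1]
    rcases lt_or_ge (r + d) x with h2 | h2
    · rw [hκC_L h1 h2, h2P_L h2]
      have h3' := hG2Px h2
      set Gv : ℝ := (1 - x) * (r + d) + x ^ 2 with hGv
      have h3 : (1 - Gv) ≠ 0 := by linarith
      have h4 : Gv ≠ 0 := hG2P.ne'
      field_simp
    · rw [hκC_H h1 h2 (by linarith), h2P_H h2 (by linarith)]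
      have h3 : (1 - (r + d)) ≠ 0 := by
        have : r + d < 1 := by linarith
        linarith
      have h4 : r + d ≠ 0 := hApos.ne'
      field_simp
  have hκBe : r + d + 2 * t < w + t → κB * e22 = e12 := by
    intro h1
    have hB0 : r + d + 2 * t ≠ 0 := hBpos.ne'
    rw [h12_H h1]
    rcases lt_or_ge (r + d) (x * w) with h2 | h2
    · rw [hκB_L h1 h2, h22_L h2]
      have h3' := hG22w h2
      set Gv : ℝ := (1 - x) * (r + d) + x ^ 2 * w with hGv
      have h3 : (w - Gv) ≠ 0 := by linarith
      have h4 : Gv ≠ 0 := hG22.ne'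
      field_simp
    · rw [hκB_H h1 h2 (by linarith), h22_H h2 (by linarith)]
      have h3 : (w - (r + d)) ≠ 0 := by
        have : r + d < w := by linarith
        linarith
      have h4 : r + d ≠ 0 := hApos.ne'
      field_simp
  have hκAe : r + d + 2 * t < w → κA * e21 = e11 := by
    intro h1
    have hB0 : r + d + 2 * t ≠ 0 := hBpos.ne'
    rw [h11_H h1]
    rcases lt_or_ge (r + d) (x * (w - t)) with h2 | h2
    · rw [hκA_L h1 h2, h21_L h2]
      obtain ⟨hG21, hG21', hxwt'⟩ := hG21w h2
      set Gv : ℝ := (1 - x) * (r + d) + x ^ 2 * (w - t) with hGv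
      have h3 : ((w - t) - Gv) ≠ 0 := by linarith
      have h4 : Gv ≠ 0 := hG21.ne'
      field_simp
    · rw [hκA_H h1 h2 (by linarith), h21_H h2 (by linarith)]
      have h3 : ((w - t) - (r + d)) ≠ 0 := by
        have : r + d < w - t := by linarith
        linarith
      have h4 : r + d ≠ 0 := hApos.ne'
      field_simp
  exact ⟨e2P, e22, e21, e1P, e12, e11, κC, κB, κA, h2P_N, h2P_H, h2P_L, h22_N, h22_H, h22_L, h21_N, h21_H, h21_L, h1P_N, h1P_H, h12_N, h12_H, h11_N, h11_H, he2P0, he220, he210, he1P0, he120, he110, hκC_N, hκC_H, hκC_L, hκB_N, hκB_H, hκB_L, hκA_N, hκA_H, hκA_L, hκC0, hκB0, hκA0, hκCe, hκBe, hκAe⟩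

end LSCoreMMG

end LawDec

end Quant

end Summit.CriticalPhenomena.PercolationContinuityZ3.Theorems
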